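import Mathlib
import Summits.ValiantsHypothesis.ValiantsHypothesis.Theses.GeneratorObstructions

/-!
# ValiantsHypothesis / GeneratorObstructions — the kill criterion: `NoGenFlipBeyondPoly` excludes `GenFlipThesis`

Route `ValiantsHypothesis/GeneratorObstructions`, support item `stmt-ValiantsHypothesis-11663`
(`NoGenFlipBeyondPoly`, the route's NEGATIVE side: from some polynomial matrix size
`n = m + e ≥ m ^ c₀` on there is no generator obstruction `γ_χ(tr X^m) < γ_χ(per_m)`).
The route's thesis docstring states the KILL CRITERION informally ("a proof refutes
`GenFlipThesis`: the window `[m, 2^((log₂ m + c)^c)]` contains `n = m^c₀` once `c > c₀`").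
This file makes it a theorem: the elementary arithmetic
`max (m ^ c₀) m ≤ 2 ^ ((Nat.log 2 m + (c₀ + 1)) ^ (c₀ + 1))` places the polynomial size inside the
quasi-polynomial window with constant `c₀ + 1`, so the two route declarations
`NoGenFlipBeyondPoly` (item 11663) and `GenFlipThesis` (target, item 11653) are jointly
inconsistent. Both directions are recorded (`not_genFlipThesis_of_noGenFlipBeyondPoly`,
`noGenFlipBeyondPoly_false_of_genFlipThesis`); neither declaration is asserted.
-/

namespace Summit.ValiantsHypothesis.ValiantsHypothesis.Theorems.GeneratorObstructions

open Summit.ValiantsHypothesis.ValiantsHypothesis.Theses.GeneratorObstructions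

/-- Window arithmetic, polynomial sizes: `m ^ c ≤ 2 ^ ((log₂ m + (c + 1)) ^ (c + 1))` for all
`m c : ℕ` (from `m < 2 ^ (log₂ m + 1)`, so `m ^ c ≤ 2 ^ ((log₂ m + 1) c)`, and
`(log₂ m + 1) c ≤ (log₂ m + c + 1) ^ (c + 1)` because `c ≤ (log₂ m + c + 1) ^ c`). [folklore] -/
theorem pow_le_two_pow_log_add_succ_pow (m c : ℕ) :
    m ^ c ≤ 2 ^ ((Nat.log 2 m + (c + 1)) ^ (c + 1)) := by
  set L := Nat.log 2 m with hL
  have h1 : m < 2 ^ (L + 1) := Nat.lt_pow_succ_log_self (by norm_num) m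
  have key : c ≤ (L + (c + 1)) ^ c := by
    rcases Nat.eq_zero_or_pos c with rfl | hc
    · simp
    · calc c ≤ 2 ^ c := (Nat.lt_two_pow_self).le
        _ ≤ (L + (c + 1)) ^ c := Nat.pow_le_pow_left (by omega) c
  have hexp : (L + 1) * c ≤ (L + (c + 1)) ^ (c + 1) :=
    calc (L + 1) * c ≤ (L + (c + 1)) * c := Nat.mul_le_mul_right c (by omega)
      _ ≤ (L + (c + 1)) * (L + (c + 1)) ^ c := Nat.mul_le_mul_left _ key
      _ = (L + (c + 1)) ^ (c + 1) := by rw [pow_succ']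
  calc m ^ c ≤ (2 ^ (L + 1)) ^ c := Nat.pow_le_pow_left h1.le c
    _ = 2 ^ ((L + 1) * c) := by rw [← pow_mul]
    _ ≤ 2 ^ ((L + (c + 1)) ^ (c + 1)) := Nat.pow_le_pow_right (by norm_num) hexp

/-- Window arithmetic: the polynomial matrix size `max (m ^ c) m` lies in the quasi-polynomial
window with constant `c + 1`, i.e. `max (m ^ c) m ≤ 2 ^ ((log₂ m + (c + 1)) ^ (c + 1))`
(`pow_le_two_pow_log_add_succ_pow` for the first component; `m < 2 ^ (log₂ m + 1)` and
`log₂ m + 1 ≤ (log₂ m + c + 1) ^ (c + 1)` for the second). [folklore] -/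
theorem max_pow_self_le_two_pow_log_add_succ_pow (m c : ℕ) :
    max (m ^ c) m ≤ 2 ^ ((Nat.log 2 m + (c + 1)) ^ (c + 1)) := by
  refine max_le (pow_le_two_pow_log_add_succ_pow m c) ?_
  have h1 : m < 2 ^ (Nat.log 2 m + 1) := Nat.lt_pow_succ_log_self (by norm_num) m
  have h2 : Nat.log 2 m + 1 ≤ (Nat.log 2 m + (c + 1)) ^ (c + 1) :=
    calc Nat.log 2 m + 1 ≤ Nat.log 2 m + (c + 1) := by omega
      _ ≤ (Nat.log 2 m + (c + 1)) ^ (c + 1) := Nat.le_self_pow (by omega) _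
  exact h1.le.trans (Nat.pow_le_pow_right (by norm_num) h2)

/-- **Kill criterion of route GeneratorObstructions, made formal.** The negative-side support
item `NoGenFlipBeyondPoly` (stmt-ValiantsHypothesis-11663: beyond some polynomial matrix size
`m + e ≥ m ^ c₀`, `γ_χ(per_m) ≤ γ_χ(tr X^m)` for every weight `χ`) refutes the route's target
`GenFlipThesis` (stmt-ValiantsHypothesis-11653: for every `c`, infinitely many `m ≥ 1` admit a
generator flip `γ_χ(tr X^m) < γ_χ(per_m)` at EVERY size `m + e ≤ 2 ^ ((log₂ m + c) ^ c)`).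
Proof: given `c₀, m₀` from the hypothesis, run `GenFlipThesis` with `c := c₀ + 1` and the same
`m₀`; at the size `n := max (m ^ c₀) m`, which lies in the window by
`max_pow_self_le_two_pow_log_add_succ_pow`, the promised flip contradicts
the hypothesis at `e := n - m`. Neither declaration is asserted here. [folklore] -/
theorem not_genFlipThesis_of_noGenFlipBeyondPoly :
    NoGenFlipBeyondPoly → ¬ GenFlipThesis := by
  rintro ⟨c₀, m₀, hS⟩ hX
  obtain ⟨m, hm₀, -, hwin⟩ := hX (c₀ + 1) m₀
  set n := max (m ^ c₀) m with hn
  have hmn : m ≤ n := le_max_right _ _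
  have hsize : m + (n - m) = n := Nat.add_sub_cancel' hmn
  have hwindow : m + (n - m) ≤ 2 ^ ((Nat.log 2 m + (c₀ + 1)) ^ (c₀ + 1)) := by
    rw [hsize]
    exact max_pow_self_le_two_pow_log_add_succ_pow m c₀
  have hpoly : m ^ c₀ ≤ m + (n - m) := by
    rw [hsize]
    exact le_max_left _ _
  obtain ⟨χ, hχ⟩ := hwin (n - m) hwindow
  exact absurd (hS m (n - m) hm₀ hpoly χ) (not_le.mpr hχ)

/-- Contrapositive form of the kill criterion: the route's target `GenFlipThesis`
(stmt-ValiantsHypothesis-11653) refutes the negative-side item `NoGenFlipBeyondPoly`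
(stmt-ValiantsHypothesis-11663). Recorded so that a proof of either item closes the other by
`modus ponens`; neither is asserted. [folklore] -/
theorem noGenFlipBeyondPoly_false_of_genFlipThesis :
    GenFlipThesis → ¬ NoGenFlipBeyondPoly :=
  fun hX hS => not_genFlipThesis_of_noGenFlipBeyondPoly hS hX

end Summit.ValiantsHypothesis.ValiantsHypothesis.Theorems.GeneratorObstructions
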